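import Mathlib
import Summits.Ventures.HodgeRepro.BallGenSylvester
import Summits.Ventures.HodgeRepro.CayleyDensity

/-!
# Real approximation for `U(H_K)` at one archimedean place — the density input of Lemma W

`BallGenSylvester.lemmaW_rational_of` proves Lemma W (ROUTE.md Appendix A4, the wedge step of
Route C's R5) on the rational points `ratPointsOf φ₀ H_K P hP ≤ U(p,1)` of the unitary group of
any Hermitian form `H_K` over a CM field `K` of signature `(p,1)` at `φ₀`, MODULO the density
hypothesis `hdense : Dense (ratPointsOf …)` — the printed real-approximation theorem (Milne AG
Thm 25.70 / Poonen GSM 186 Thm 5.10.4(a)), typed by lit-2 as `Lit2.RealApproximation_unitary`.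

This file PROVES that density: **`dense_ratPointsOf`** — for every CM field `K`, `p`, embedding
`φ₀`, Hermitian `H_K ∈ M_{p+1}(K)` and Sylvester matrix `P` with `Pᴴ (φ₀ H_K) P = J`,
`ratPointsOf φ₀ H_K P hP` is dense in `U(p,1)`.  The proof is the Cayley-transform argument of
`CayleyDensity.lean` (no structure theory of algebraic groups): every `g ∈ U(φ₀ H_K)` is a limit of
`e^{iθ} g` with `det (1 + e^{iθ} g) ≠ 0`; such a matrix is `cayley X` for an `H`-skew `X`; `X` is
a limit of images of `H_K`-skew `K`-matrices (rational antisymmetric + `δ` · rational symmetric,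
`star δ = -δ`); and `cayley` is continuous there and commutes with `φ₀`.  The transfer to the
subgroup topology of `U(p,1) ⊆ GL_{p+1}(ℂ)` uses that `mat` is inducing (`g⁻¹ = J gᴴ J`) and that
`conjToU P` is conjugation by the Sylvester matrix.
-/

namespace HodgeRepro.BallGen.RealApprox

open Matrix Topology NumberField HodgeRepro.Cayley

variable {p : ℕ}

/-! ### `mat` is inducing on `U(p,1)` (as in BallGenSealed, restated here without the sealed import) -/

/-- `mat g * mat g⁻¹ = 1`. -/
theorem mat_mul_mat_inv (g : U p) : mat g * mat g⁻¹ = 1 := by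
  rw [mat, mat, Subgroup.coe_inv, Units.mul_inv]

/-- On `U(p,1)` the inverse is `g⁻¹ = J gᴴ J`. -/
theorem mat_inv (g : U p) : mat g⁻¹ = J p * (mat g)ᴴ * J p := by
  have h := mat_mem g
  have h2 : (mat g)ᴴ * J p = J p * mat g⁻¹ := by
    calc (mat g)ᴴ * J p = (mat g)ᴴ * J p * (mat g * mat g⁻¹) := by
          rw [mat_mul_mat_inv, Matrix.mul_one]
      _ = ((mat g)ᴴ * J p * mat g) * mat g⁻¹ := by simp only [Matrix.mul_assoc]
      _ = J p * mat g⁻¹ := by rw [h]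
  symm
  calc J p * (mat g)ᴴ * J p = J p * ((mat g)ᴴ * J p) := by rw [Matrix.mul_assoc]
    _ = J p * (J p * mat g⁻¹) := by rw [h2]
    _ = mat g⁻¹ := by rw [← Matrix.mul_assoc, J_mul_J, Matrix.one_mul]

/-- The inverse, read in `GL`, as a function of `mat g`. -/
theorem coe_inv_eq (g : U p) : ((g : GLp p)⁻¹ : GLp p).val = J p * (mat g)ᴴ * J p := by
  rw [← mat_inv]
  rfl

/-- **`mat` is inducing** on `U(p,1)`: its topology is the one induced by the matrix entries. -/
theorem isInducing_mat : IsInducing (mat : U p → Matrix (Idx p) (Idx p) ℂ) := by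
  constructor
  apply le_antisymm
  · exact continuous_iff_le_induced.1 continuous_mat
  · letI τ : TopologicalSpace (U p) := TopologicalSpace.induced mat inferInstance
    have hval : @Continuous (U p) (GLp p) τ _ (Subtype.val : U p → GLp p) := by
      rw [Units.continuous_iff]
      constructor
      · exact continuous_induced_dom
      · have hfun : (fun g : U p => ((g : GLp p)⁻¹ : GLp p).val) =
            fun g => J p * (mat g)ᴴ * J p := by
          funext g
          exact coe_inv_eq g
        show @Continuous (U p) _ τ _ (fun g : U p => ((g : GLp p)⁻¹ : GLp p).val)
        rw [hfun]
        have hmat : @Continuous (U p) _ τ _ mat := continuous_induced_dom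
        exact (continuous_const.matrix_mul hmat.matrix_conjTranspose).matrix_mul continuous_const
    exact continuous_iff_le_induced.1 hval

/-- A subset of `U(p,1)` is dense iff every `mat g` lies in the closure of its image in matrix
space. -/
theorem dense_iff_mat (S : Set (U p)) : Dense S ↔ ∀ g : U p, mat g ∈ closure (mat '' S) :=
  isInducing_mat.dense_iff

/-! ### The Hermitian form behind a Sylvester matrix -/

/-- `J` is Hermitian. -/
theorem J_conjTranspose : (J p)ᴴ = J p := by
  rw [J, diagonal_conjTranspose]
  congr 1
  funext i
  rcases i with i | i <;> simp

/-- `det J ≠ 0`. -/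
theorem det_J_ne_zero : (J p).det ≠ 0 := by
  rw [J, det_diagonal]
  refine Finset.prod_ne_zero_iff.2 fun i _ => ?_
  rcases i with i | i <;> simp

variable {K : Type*} [Field K] [NumberField K] [IsCMField K]

/-- With a Sylvester matrix `P` (`Pᴴ H P = J`), `H = (P⁻¹)ᴴ J P⁻¹`. -/
theorem eq_of_sylvester {H : Matrix (Idx p) (Idx p) ℂ} {P : GLp p}
    (hP : (P : Matrix (Idx p) (Idx p) ℂ)ᴴ * H * (P : Matrix (Idx p) (Idx p) ℂ) = J p) :
    H = ((P⁻¹ : GLp p) : Matrix (Idx p) (Idx p) ℂ)ᴴ * J p *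
      ((P⁻¹ : GLp p) : Matrix (Idx p) (Idx p) ℂ) := by
  set Pm : Matrix (Idx p) (Idx p) ℂ := (P : Matrix (Idx p) (Idx p) ℂ) with hPm
  set Pi : Matrix (Idx p) (Idx p) ℂ := ((P⁻¹ : GLp p) : Matrix (Idx p) (Idx p) ℂ) with hPi
  have h1 : Pm * Pi = 1 := by rw [hPm, hPi, ← Units.val_mul, mul_inv_cancel, Units.val_one]
  rw [← hP]
  calc H = (Pm * Pi)ᴴ * H * (Pm * Pi) := by rw [h1, conjTranspose_one, Matrix.one_mul, Matrix.mul_one]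
    _ = Piᴴ * (Pmᴴ * H * Pm) * Pi := by simp only [conjTranspose_mul, Matrix.mul_assoc]

/-- The Hermitian form behind a Sylvester matrix is Hermitian over `K`. -/
theorem conjTranspose_eq_of_sylvester (φ₀ : K →+* ℂ) {HK : Matrix (Idx p) (Idx p) K} {P : GLp p}
    (hP : (P : Matrix (Idx p) (Idx p) ℂ)ᴴ * HK.map φ₀ * (P : Matrix (Idx p) (Idx p) ℂ) = J p) :
    HKᴴ = HK := by
  apply Matrix.map_injective φ₀.injective
  show HKᴴ.map φ₀ = HK.map φ₀
  rw [conjTranspose_map_emb]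
  conv_rhs => rw [eq_of_sylvester hP]
  conv_lhs => rw [eq_of_sylvester hP]
  simp only [conjTranspose_mul, conjTranspose_conjTranspose, J_conjTranspose, Matrix.mul_assoc]

omit [NumberField K] [IsCMField K] in
/-- The Hermitian form behind a Sylvester matrix is invertible over `K`. -/
theorem isUnit_det_of_sylvester (φ₀ : K →+* ℂ) {HK : Matrix (Idx p) (Idx p) K} {P : GLp p}
    (hP : (P : Matrix (Idx p) (Idx p) ℂ)ᴴ * HK.map φ₀ * (P : Matrix (Idx p) (Idx p) ℂ) = J p) :
    IsUnit HK.det := by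
  rw [isUnit_iff_ne_zero]
  intro h0
  apply det_J_ne_zero (p := p)
  rw [← hP, det_mul, det_mul]
  have : (HK.map φ₀).det = φ₀ HK.det := by rw [← RingHom.mapMatrix_apply, RingHom.map_det]
  rw [this, h0, map_zero, mul_zero, zero_mul]

/-! ### The theorem -/

/-- **Real approximation for the unitary group of a Hermitian form over a CM field, at one
archimedean place** (the `hdense` hypothesis of `lemmaW_rational_of`; Milne AG Thm 25.70 /
Poonen GSM 186 Thm 5.10.4(a) for `Res_{K⁺/ℚ} U(K^{p+1}, H_K)`, proved here by the Cayley
transform): for every Hermitian `H_K ∈ M_{p+1}(K)` with a Sylvester matrix `P` at `φ₀`,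
the image `ratPointsOf φ₀ H_K P hP` of the `K`-points `unitaryGroupOf H_K` is dense in `U(p,1)`. -/
theorem dense_ratPointsOf (φ₀ : K →+* ℂ) (HK : Matrix (Idx p) (Idx p) K) (P : GLp p)
    (hP : (P : Matrix (Idx p) (Idx p) ℂ)ᴴ * HK.map φ₀ * (P : Matrix (Idx p) (Idx p) ℂ) = J p) :
    Dense ((ratPointsOf φ₀ HK P hP : Subgroup (U p)) : Set (U p)) := by
  have hHK : HKᴴ = HK := conjTranspose_eq_of_sylvester φ₀ hP
  have hdet : IsUnit HK.det := isUnit_det_of_sylvester φ₀ hP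
  rw [dense_iff_mat]
  intro u
  set H : Matrix (Idx p) (Idx p) ℂ := HK.map φ₀ with hH
  set Pm : Matrix (Idx p) (Idx p) ℂ := (P : Matrix (Idx p) (Idx p) ℂ) with hPm
  set Pi : Matrix (Idx p) (Idx p) ℂ := ((P⁻¹ : GLp p) : Matrix (Idx p) (Idx p) ℂ) with hPi
  have hPP : Pm * Pi = 1 := by rw [hPm, hPi, ← Units.val_mul, mul_inv_cancel, Units.val_one]
  have hPiP : Pi * Pm = 1 := by rw [hPm, hPi, ← Units.val_mul, inv_mul_cancel, Units.val_one]
  -- `P u P⁻¹` is `H`-unitary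
  have hh : IsUnitaryFor H (Pm * mat u * Pi) := by
    unfold IsUnitaryFor
    have hH' : H = Piᴴ * J p * Pi := eq_of_sylvester hP
    have hu : (mat u)ᴴ * J p * mat u = J p := mat_mem u
    rw [hH']
    calc (Pm * mat u * Pi)ᴴ * (Piᴴ * J p * Pi) * (Pm * mat u * Pi)
        = Piᴴ * (mat u)ᴴ * ((Pi * Pm)ᴴ * J p * (Pi * Pm)) * mat u * Pi := by
          simp only [conjTranspose_mul, Matrix.mul_assoc]
      _ = Piᴴ * ((mat u)ᴴ * J p * mat u) * Pi := by
          rw [hPiP, conjTranspose_one, Matrix.one_mul, Matrix.mul_one]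
          simp only [Matrix.mul_assoc]
      _ = Piᴴ * J p * Pi := by rw [hu]
  have hcl : Pm * mat u * Pi ∈ closure (kUnitary φ₀ HK) := mem_closure_kUnitary φ₀ hHK hdet hh
  -- conjugate back by `P⁻¹ · P`, which maps the `K`-points into `mat '' ratPointsOf`
  have hc : Continuous fun m : Matrix (Idx p) (Idx p) ℂ => Pi * m * Pm :=
    (continuous_const.matrix_mul continuous_id).matrix_mul continuous_const
  have hmaps : Set.MapsTo (fun m : Matrix (Idx p) (Idx p) ℂ => Pi * m * Pm) (kUnitary φ₀ HK)
      (mat '' ((ratPointsOf φ₀ HK P hP : Subgroup (U p)) : Set (U p))) := by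
    rintro _ ⟨g, hg, rfl⟩
    have hgdet : IsUnit g.det := hg.isUnit_det hdet
    have hgu : IsUnit g := (Matrix.isUnit_iff_isUnit_det g).2 hgdet
    have hĝ : hgu.unit ∈ unitaryGroupOf HK := by
      rw [mem_unitaryGroupOf, IsUnit.unit_spec]
      exact hg
    refine ⟨conjToU P hP (embUof φ₀ HK ⟨hgu.unit, hĝ⟩), ?_, ?_⟩
    · exact MonoidHom.mem_range.2 ⟨⟨hgu.unit, hĝ⟩, rfl⟩
    · rw [mat_conjToU]
      have : (((embUof φ₀ HK ⟨hgu.unit, hĝ⟩ : unitaryOf (HK.map φ₀)) : GLp p) :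
          Matrix (Idx p) (Idx p) ℂ) = g.map φ₀ := by
        show ((hgu.unit : GL (Idx p) K) : Matrix (Idx p) (Idx p) K).map φ₀ = g.map φ₀
        rw [IsUnit.unit_spec]
      rw [this]
  have := map_mem_closure hc hcl hmaps
  have hid : Pi * (Pm * mat u * Pi) * Pm = mat u := by
    calc Pi * (Pm * mat u * Pi) * Pm = (Pi * Pm) * mat u * (Pi * Pm) := by
          simp only [Matrix.mul_assoc]
      _ = mat u := by rw [hPiP, Matrix.one_mul, Matrix.mul_one]
  rw [hid] at this
  exact this

/-! ### Lemma W on the rational points, UNCONDITIONALLY -/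

/-- **Lemma W (ROUTE.md Appendix A4) on the rational points of any Hermitian form of signature
`(p,1)` over a CM field, with no density hypothesis**: `lemmaW_rational_of` with `hdense`
discharged by `dense_ratPointsOf`. -/
theorem lemmaW_of_sylvester {i : ℕ} (hi : i < p) (φ₀ : K →+* ℂ) (HK : Matrix (Idx p) (Idx p) K)
    (P : GLp p) (hP : (P : Matrix (Idx p) (Idx p) ℂ)ᴴ * HK.map φ₀ * (P : Matrix (Idx p) (Idx p) ℂ) = J p)
    (v : Ball p → Fin i → Fin p → ℂ) {ω : Ball p → Fin p → ℂ} (hω : Continuous ω)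
    (hv : ∃ z, LinearIndependent ℂ (v z)) (hω0 : ∃ w, ω w ≠ 0) :
    ∃ g : unitaryGroupOf HK, ∃ z : Ball p, LinearIndependent ℂ (v z) ∧
      pullback (conjToU P hP (embUof φ₀ HK g)) ω z ∉ Submodule.span ℂ (Set.range (v z)) :=
  lemmaW_rational_of hi φ₀ HK P hP (dense_ratPointsOf φ₀ HK P hP) v hω hv hω0

/-- The split form `J_K` with `P = 1`: the `K`-points `UK K p` are dense in `U(p,1)`
(the `hdense` of `lemmaW_rational`). -/
theorem dense_ratPoints (φ₀ : K →+* ℂ) :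
    Dense ((ratPoints K p φ₀ : Subgroup (U p)) : Set (U p)) := by
  have h1 : ((1 : GLp p) : Matrix (Idx p) (Idx p) ℂ)ᴴ * (JK K p).map φ₀ *
      ((1 : GLp p) : Matrix (Idx p) (Idx p) ℂ) = J p := by
    rw [map_JK, Units.val_one, conjTranspose_one, one_mul, mul_one]
  have h := dense_ratPointsOf φ₀ (JK K p) 1 h1
  have heq : ratPointsOf φ₀ (JK K p) 1 h1 = ratPoints K p φ₀ := by
    ext γ
    simp only [ratPointsOf, ratPoints, MonoidHom.mem_range, MonoidHom.comp_apply]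
    constructor
    · rintro ⟨g, rfl⟩
      refine ⟨⟨(g : GL (Idx p) K), g.2⟩, ?_⟩
      apply Subtype.ext
      show embGL φ₀ (g : GL (Idx p) K) = (1 : GLp p)⁻¹ * embGL φ₀ (g : GL (Idx p) K) * 1
      rw [inv_one, one_mul, mul_one]
    · rintro ⟨g, rfl⟩
      refine ⟨⟨(g : GL (Idx p) K), g.2⟩, ?_⟩
      apply Subtype.ext
      show (1 : GLp p)⁻¹ * embGL φ₀ (g : GL (Idx p) K) * 1 = embGL φ₀ (g : GL (Idx p) K)
      rw [inv_one, one_mul, mul_one]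
  rwa [heq] at h

/-- **Lemma W on the split rational points `UK K p`, unconditionally.** -/
theorem lemmaW_split {i : ℕ} (hi : i < p) (φ₀ : K →+* ℂ)
    (v : Ball p → Fin i → Fin p → ℂ) {ω : Ball p → Fin p → ℂ} (hω : Continuous ω)
    (hv : ∃ z, LinearIndependent ℂ (v z)) (hω0 : ∃ w, ω w ≠ 0) :
    ∃ g : UK K p, ∃ z : Ball p, LinearIndependent ℂ (v z) ∧
      pullback (embU φ₀ g) ω z ∉ Submodule.span ℂ (Set.range (v z)) :=
  lemmaW_rational hi φ₀ (dense_ratPoints φ₀) v hω hv hω0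

end HodgeRepro.BallGen.RealApprox
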